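import Literature.Combinatorics.StablePolynomials.Homogenization
import Literature.Combinatorics.StablePolynomials.RealRootedRestriction
import Literature.Algebra.Polynomial.NewtonInequalities
import HarnessLib

/-!
# Newton-type inequalities for the homogeneous parts of a real stable polynomial with non-negative
# coefficients (Borcea–Brändén–Liggett, Corollary 4.17)

J. Borcea, P. Brändén, T. M. Liggett, *Negative dependence and the geometry of polynomials*, J. Amer. Math.
Soc. 22 (2009) 521–567 (arXiv:0707.2340, held `paper:arxiv-0707.2340`; numbering of the arXiv version), §4.3.2.
Verbatim:

> **Lemma 4.16.** Suppose that `f(z) = Σ_α a(α) z^α ∈ ℝ[z_1,…,z_n]` is stable of total degree at most `d` and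
> has non-negative coefficients. For `0 ≤ k ≤ d` let `E_k(z) = Σ_{|α| = k} a(α) z^α`. […]
> The above lemma gives the following generalization of Newton's inequalities, which correspond to the special
> case when `f(z) = (1+z_1)⋯(1+z_n)`.
> **Corollary 4.17.** Let `f(z)` and `E_k(z)`, `k = 0,…,d`, be as in the statement of Lemma 4.16. Then
> `E_k²(z)/binom(d,k)² ≥ E_{k-1}(z)/binom(d,k-1) · E_{k+1}(z)/binom(d,k+1)`, `z ∈ ℝ^n`, `1 ≤ k ≤ d-1`.
> *Proof.* By Lemma 4.16, the polynomial
> `(z,y) ↦ E_{k-1}(z)/binom(d,k-1) y² + 2 E_k(z)/binom(d,k) y + E_{k+1}(z)/binom(d,k+1)` is stable. Hence, for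
> any fixed `z ∈ ℝ^n` the resulting (univariate) polynomial in `y` is real-rooted. The corollary follows upon
> taking the discriminant. □

## Route (deviation from the printed proof, same ingredients)

BBL take the discriminant of the three-term case `q - p = 2` of Lemma 4.16. Here the real-rooted univariate
polynomial is the whole line restriction `y ↦ f_H(z, y) = Σ_k E_k(z) y^{d-k}` of the homogenization `f_H`
(`homogenizeLine`; real stable by Thm. 4.5, tree `IsRealStable.homogenize`; its restriction to the line
`(z, 0) + y e_{n+1}` with the non-negative direction `e_{n+1}` is real-rooted or zero, Prop. 3.1 (1), tree
`IsRealStable.aeval_line_eq_zero_or_im_eq_zero`), and "the familiar Newton inequalities" (tree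
`Literature.Algebra.Polynomial.NewtonInequalities.coeff_mul_coeff_le_sq_newton`, Bóna (1.14)) are applied to its
coefficients `[y^j] = E_{d-j}(z)` (`coeff_homogenizeLine`), after passing from the actual degree to the formal
degree `d` (`newton_coeff_mul_coeff_le_sq_of_natDegree_le`). Lemma 4.16 itself (general `p ≤ q`) is not
formalized here; its case `q - p = 1` is `Literature.Probability.NegativeDependence.isProperPosition_homogeneousComponent`
(`TruncationStochasticDomination.lean`). -- TODO(general form): Lemma 4.16 for `q - p ≥ 2`.

## Contents

* §1 `coeff_optionEquivLeft_homogenize`, `homogenizeLine d f x` with `coeff_homogenizeLine` (`= E_{d-j}(x)`),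
  `natDegree_homogenizeLine_le`, **`splits_homogenizeLine`** (real-rooted).
* §2 `newton_coeff_mul_coeff_le_sq_of_natDegree_le`, `newton_coeff_div_choose` (Newton with a formal degree).
* §3 **`BorceaBrandenLiggett_cor_4_17`** (as printed, binomial form) and `BorceaBrandenLiggett_cor_4_17'`
  (cross-multiplied: `(k+1)(d-k+1) E_{k-1} E_{k+1} ≤ k(d-k) E_k²`).

## References

* [BorceaBrandenLiggett2007] J. Borcea, P. Brändén, T. M. Liggett, Negative dependence and the geometry of
  polynomials, J. Amer. Math. Soc. 22 (2009), 521–567; arXiv:0707.2340.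
* [Bona2012] M. Bóna, Combinatorics of Permutations, 2nd ed., §1.1 Thm. 1.32 (Newton's inequalities; tree
  `Literature/Algebra/Polynomial/NewtonInequalities.lean`).
-/

noncomputable section

open Finset MvPolynomial Polynomial

namespace Literature.Combinatorics.StablePolynomials

variable {σ : Type*} [Fintype σ] [DecidableEq σ]

/-! ## §1 The line `y ↦ f_H(x, y)` through a real point: `Σ_k E_k(x) y^{d-k}` -/

section Line

omit [Fintype σ] [DecidableEq σ] in
/-- The coefficient of `y^j` in `f_H = Σ_k E_k(z) y^{d-k}` is `E_{d-j}` (`deg f ≤ d`, `j ≤ d`), any coefficients.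
[cite: BorceaBrandenLiggett2007, §4.3.2 proof of Lemma 4.16 ("`f_1(z,y) = Σ_k E_k(z) y^{d-k}`")] -/
theorem coeff_optionEquivLeft_homogenize {R : Type*} [CommSemiring R] {f : MvPolynomial σ R} {d : ℕ}
    (hd : f.totalDegree ≤ d) {j : ℕ} (hj : j ≤ d) :
    (optionEquivLeft R σ (homogenize d f)).coeff j = homogeneousComponent (d - j) f := by
  ext n
  rw [optionEquivLeft_coeff_coeff, coeff_homogenize, coeff_homogeneousComponent, Finsupp.optionElim_apply_none,
    Finsupp.some_optionElim]
  by_cases hn : n.degree = d - j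
  · rw [if_pos hn, if_pos (by omega)]
  · rw [if_neg hn]
    by_cases hj' : j = d - n.degree
    · rw [if_pos hj']
      have hlt : f.totalDegree < n.degree := by omega
      rw [coeff_eq_zero_of_totalDegree_lt hlt]
    · rw [if_neg hj']

/-- **The restriction of `f_H` to the line `{(x, y) : y ∈ ℝ}`** through a real point `x`, as a univariate real
polynomial: `aeval (y ↦ X, z_i ↦ x_i) f_H`. [cite: BorceaBrandenLiggett2007, §4.3.2 proof of Cor. 4.17 ("for any
fixed `z ∈ ℝ^n` the resulting (univariate) polynomial in `y`")] -/
def homogenizeLine (d : ℕ) (f : MvPolynomial σ ℝ) (x : σ → ℝ) : ℝ[X] :=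
  MvPolynomial.aeval
    (fun j : Option σ => if j = none then (Polynomial.X : ℝ[X]) else Polynomial.C (Option.elim j 0 x)) (homogenize d f)

omit [Fintype σ] [DecidableEq σ] in
/-- `aeval (y ↦ X, z_i ↦ x_i) = map (eval x) ∘ optionEquivLeft` (two algebra maps agreeing on the variables).
[folklore] -/
private theorem aeval_line_eq_map_optionEquivLeft (x : σ → ℝ) (P : MvPolynomial (Option σ) ℝ) :
    MvPolynomial.aeval (fun j : Option σ => if j = none then (Polynomial.X : ℝ[X]) else Polynomial.C (Option.elim j 0 x))
        P = Polynomial.map (eval x) (optionEquivLeft ℝ σ P) := by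
  have h : (MvPolynomial.aeval fun j : Option σ =>
      if j = none then (Polynomial.X : ℝ[X]) else Polynomial.C (Option.elim j 0 x)) =
      (Polynomial.mapAlgHom (MvPolynomial.aeval x)).comp (optionEquivLeft ℝ σ).toAlgHom := by
    refine MvPolynomial.algHom_ext fun j => ?_
    rcases j with _ | i
    · simp
    · simp
  rw [h]
  rfl

omit [Fintype σ] [DecidableEq σ] in
/-- **`[y^j] f_H(x, y) = E_{d-j}(x)`** for `j ≤ d` (`deg f ≤ d`). [cite: BorceaBrandenLiggett2007, §4.3.2 proof of
Lemma 4.16 / Cor. 4.17] -/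
theorem coeff_homogenizeLine {f : MvPolynomial σ ℝ} {d : ℕ} (hd : f.totalDegree ≤ d) (x : σ → ℝ) {j : ℕ}
    (hj : j ≤ d) : (homogenizeLine d f x).coeff j = eval x (homogeneousComponent (d - j) f) := by
  rw [homogenizeLine, aeval_line_eq_map_optionEquivLeft, Polynomial.coeff_map, coeff_optionEquivLeft_homogenize hd hj]

omit [Fintype σ] [DecidableEq σ] in
/-- `[y^j] f_H(x, y) = 0` for `j > d`. [cite: BorceaBrandenLiggett2007, §4.3.2] -/
theorem coeff_homogenizeLine_eq_zero {f : MvPolynomial σ ℝ} {d : ℕ} (hd : f.totalDegree ≤ d) (x : σ → ℝ) {j : ℕ}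
    (hj : d < j) : (homogenizeLine d f x).coeff j = 0 := by
  rw [homogenizeLine, aeval_line_eq_map_optionEquivLeft, Polynomial.coeff_map]
  have h0 : (optionEquivLeft ℝ σ (homogenize d f)).coeff j = 0 := by
    ext n
    rw [optionEquivLeft_coeff_coeff, coeff_homogenize, MvPolynomial.coeff_zero, if_neg]
    rw [Finsupp.optionElim_apply_none]
    omega
  rw [h0, map_zero]

omit [Fintype σ] [DecidableEq σ] in
/-- `deg_y f_H(x, ·) ≤ d`. [cite: BorceaBrandenLiggett2007, §4.3.2] -/
theorem natDegree_homogenizeLine_le {f : MvPolynomial σ ℝ} {d : ℕ} (hd : f.totalDegree ≤ d) (x : σ → ℝ) :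
    (homogenizeLine d f x).natDegree ≤ d := by
  rw [Polynomial.natDegree_le_iff_coeff_eq_zero]
  intro j hj
  exact coeff_homogenizeLine_eq_zero hd x (by exact_mod_cast hj)

/-- A real polynomial all of whose complex roots are real splits over `ℝ`. [folklore] -/
private theorem splits_of_aroots_real {P : ℝ[X]} (h : ∀ z ∈ P.aroots ℂ, z.im = 0) : P.Splits := by
  classical
  rw [splits_iff_card_roots]
  have hfilter := Polynomial.filter_roots_map_range_eq_map_roots (algebraMap ℝ ℂ).injective P
  have hall : ((P.map (algebraMap ℝ ℂ)).roots.filter (· ∈ (algebraMap ℝ ℂ).range)) =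
      (P.map (algebraMap ℝ ℂ)).roots := by
    refine Multiset.filter_eq_self.2 fun z hz => ?_
    exact ⟨z.re, Complex.ext (by simp) (by simp [h z hz])⟩
  rw [hall] at hfilter
  have hc := congrArg Multiset.card hfilter
  rw [Multiset.card_map, IsAlgClosed.card_roots_eq_natDegree, natDegree_map] at hc
  exact hc.symm

/-- **`y ↦ f_H(x, y)` is real-rooted** for `f` real stable with non-negative coefficients and `x ∈ ℝⁿ` (it is the
restriction of the real stable `f_H` (Thm. 4.5) to a line in the non-negative direction `e_{n+1}`, Prop. 3.1 (1);
tree `IsRealStable.aeval_line_eq_zero_or_im_eq_zero`). [cite: BorceaBrandenLiggett2007, §4.3.2 proof of Cor. 4.17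
("for any fixed `z ∈ ℝ^n` the resulting (univariate) polynomial in `y` is real-rooted")] -/
theorem splits_homogenizeLine {f : MvPolynomial σ ℝ} (hf : IsRealStable f) (hnn : ∀ m, 0 ≤ coeff m f) {d : ℕ}
    (hd : f.totalDegree ≤ d) (x : σ → ℝ) : (homogenizeLine d f x).Splits := by
  classical
  have hH : IsRealStable (homogenize d f) := hf.homogenize hnn hd
  have key := hH.aeval_line_eq_zero_or_im_eq_zero (fun j : Option σ => Option.elim j 0 x) none
  have hfun : (fun j : Option σ => if j = none then (Polynomial.X : ℝ[X]) else
      Polynomial.C ((fun j : Option σ => Option.elim j 0 x) j)) =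
      fun j : Option σ => if j = none then (Polynomial.X : ℝ[X]) else Polynomial.C (Option.elim j 0 x) := rfl
  rw [hfun] at key
  change homogenizeLine d f x = 0 ∨ ∀ t : ℂ, ((homogenizeLine d f x).map (algebraMap ℝ ℂ)).eval t = 0 → t.im = 0
    at key
  rcases key with h0 | hroots
  · rw [h0]
    exact Polynomial.Splits.zero
  · refine splits_of_aroots_real fun z hz => hroots z ?_
    by_cases hP : homogenizeLine d f x = 0
    · rw [hP, Polynomial.map_zero, Polynomial.eval_zero]
    · exact (Polynomial.mem_roots (Polynomial.map_ne_zero hP)).1 hz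

end Line

/-! ## §2 Newton's inequalities with a formal degree `d ≥ deg` -/

section Newton

/-- **Newton's inequality with a formal degree.** If `p ∈ ℝ[y]` is real-rooted with `deg p ≤ d` and
`0 < j < d` then `(j+1)(d-j+1) a_{j-1} a_{j+1} ≤ j(d-j) a_j²` (the tree's Newton inequality at `d = deg p`, Bóna
(1.14), and monotonicity of `(d-j+1)/(d-j)` in `d`). [cite: BorceaBrandenLiggett2007, §4.3.2 Cor. 4.17 ("the
familiar Newton inequalities", the case `f = (1+z_1)⋯(1+z_n)`)] -/
theorem newton_coeff_mul_coeff_le_sq_of_natDegree_le {p : ℝ[X]} (hp : p.Splits) {d j : ℕ} (hd : p.natDegree ≤ d)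
    (hj : 0 < j) (hjd : j < d) :
    ((j + 1) * ((d - j : ℕ) + 1) : ℝ) * (p.coeff (j - 1) * p.coeff (j + 1)) ≤
      (j * (d - j : ℕ) : ℝ) * p.coeff j ^ 2 := by
  rcases Nat.lt_or_ge j p.natDegree with hjm | hjm
  · -- `j < deg p ≤ d`: the printed inequality at `deg p`, then enlarge the degree
    have h := Literature.Algebra.Polynomial.NewtonInequalities.coeff_mul_coeff_le_sq_newton hp hj hjm
    set m := p.natDegree with hm
    set P := p.coeff (j - 1) * p.coeff (j + 1) with hP
    rcases le_or_gt P 0 with hP0 | hP0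
    · have h1 : ((j + 1) * ((d - j : ℕ) + 1) : ℝ) * P ≤ 0 :=
        mul_nonpos_of_nonneg_of_nonpos (by positivity) hP0
      have h2 : 0 ≤ (j * (d - j : ℕ) : ℝ) * p.coeff j ^ 2 := by positivity
      linarith
    · -- `(j+1)(d-j+1) P ≤ j(d-j) a_j²` from `(j+1)(m-j+1) P ≤ j(m-j) a_j²` and `m ≤ d`
      have hmj : (1 : ℝ) ≤ ((m - j : ℕ) : ℝ) := by exact_mod_cast (show 1 ≤ m - j by omega)
      have hdm : ((m - j : ℕ) : ℝ) ≤ ((d - j : ℕ) : ℝ) := by exact_mod_cast (show m - j ≤ d - j by omega)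
      have hj' : (0 : ℝ) < j := by exact_mod_cast hj
      -- `a_j² ≥ (j+1)(m-j+1) P / (j (m-j))`
      have hsq : ((j + 1) * ((m - j : ℕ) + 1) : ℝ) * P ≤ (j * (m - j : ℕ) : ℝ) * p.coeff j ^ 2 := h
      nlinarith [mul_pos hP0 hj', sq_nonneg (p.coeff j), mul_nonneg (sub_nonneg.2 hdm) hP0.le,
        mul_nonneg (sub_nonneg.2 hdm) (sq_nonneg (p.coeff j))]
  · -- `j ≥ deg p`: `a_{j+1} = 0`
    rw [Polynomial.coeff_eq_zero_of_natDegree_lt (by omega : p.natDegree < j + 1), mul_zero, mul_zero]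
    positivity

/-- The same inequality in Borcea–Brändén–Liggett's binomial form `a_{j-1} a_{j+1} / (binom(d,j-1) binom(d,j+1))
≤ a_j² / binom(d,j)²`. [cite: BorceaBrandenLiggett2007, §4.3.2 Cor. 4.17] -/
theorem newton_coeff_div_choose {p : ℝ[X]} (hp : p.Splits) {d j : ℕ} (hd : p.natDegree ≤ d) (hj : 0 < j)
    (hjd : j < d) :
    p.coeff (j - 1) / (d.choose (j - 1) : ℝ) * (p.coeff (j + 1) / (d.choose (j + 1) : ℝ)) ≤
      (p.coeff j / (d.choose j : ℝ)) ^ 2 := by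
  have h := newton_coeff_mul_coeff_le_sq_of_natDegree_le hp hd hj hjd
  have hc1 : (0 : ℝ) < d.choose (j - 1) := by exact_mod_cast Nat.choose_pos (by omega)
  have hc2 : (0 : ℝ) < d.choose (j + 1) := by exact_mod_cast Nat.choose_pos (by omega)
  have hc : (0 : ℝ) < d.choose j := by exact_mod_cast Nat.choose_pos (by omega)
  -- `binom(d,j-1) · (d-j+1) = binom(d,j) · j` and `binom(d,j+1) · (j+1) = binom(d,j) · (d-j)`
  have e1 : (d.choose (j - 1) : ℝ) * ((d - j : ℕ) + 1) = (d.choose j : ℝ) * j := by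
    have := Nat.choose_succ_right_eq d (j - 1)
    rw [show j - 1 + 1 = j by omega] at this
    have h' : d - (j - 1) = d - j + 1 := by omega
    rw [h'] at this
    exact_mod_cast this.symm
  have e2 : (d.choose (j + 1) : ℝ) * (j + 1) = (d.choose j : ℝ) * (d - j : ℕ) := by
    exact_mod_cast Nat.choose_succ_right_eq d j
  rw [div_mul_div_comm, div_pow, div_le_div_iff₀ (mul_pos hc1 hc2) (pow_pos hc 2)]
  -- multiply `h` by `binom(d,j-1) binom(d,j+1)` and use `binom(d,j)² j(d-j) = (j+1)(d-j+1) binom(d,j-1) binom(d,j+1)`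
  have hid : (d.choose j : ℝ) ^ 2 * (j * (d - j : ℕ)) =
      ((j + 1) * ((d - j : ℕ) + 1) : ℝ) * ((d.choose (j - 1) : ℝ) * d.choose (j + 1)) := by
    linear_combination (-((j : ℝ) + 1) * (d.choose (j + 1) : ℝ)) * e1 + (-(d.choose j : ℝ) * (j : ℝ)) * e2
  have key : p.coeff (j - 1) * p.coeff (j + 1) * (d.choose j : ℝ) ^ 2 * (j * (d - j : ℕ) : ℝ) ≤
      p.coeff j ^ 2 * ((d.choose (j - 1) : ℝ) * d.choose (j + 1)) * (j * (d - j : ℕ) : ℝ) := by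
    have h1 : p.coeff (j - 1) * p.coeff (j + 1) * (d.choose j : ℝ) ^ 2 * (j * (d - j : ℕ) : ℝ) =
        ((j + 1) * ((d - j : ℕ) + 1) : ℝ) * (p.coeff (j - 1) * p.coeff (j + 1)) *
          ((d.choose (j - 1) : ℝ) * d.choose (j + 1)) := by
      rw [mul_assoc (p.coeff (j - 1) * p.coeff (j + 1)), hid]; ring
    have h2 : p.coeff j ^ 2 * ((d.choose (j - 1) : ℝ) * d.choose (j + 1)) * (j * (d - j : ℕ) : ℝ) =
        (j * (d - j : ℕ) : ℝ) * p.coeff j ^ 2 * ((d.choose (j - 1) : ℝ) * d.choose (j + 1)) := by ring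
    rw [h1, h2]
    exact mul_le_mul_of_nonneg_right h (mul_nonneg hc1.le hc2.le)
  have hjd' : (0 : ℝ) < (j * (d - j : ℕ) : ℝ) := by
    have : 0 < d - j := by omega
    positivity
  exact le_of_mul_le_mul_right key hjd'

end Newton

/-! ## §3 Corollary 4.17 -/

section Cor417

/-- **Borcea–Brändén–Liggett, Corollary 4.17** (a generalization of Newton's inequalities). "Let `f(z)` and `E_k(z)`,
`k = 0,…,d`, be as in the statement of Lemma 4.16 [`f ∈ ℝ[z_1,…,z_n]` stable of total degree at most `d` with
non-negative coefficients, `E_k` its homogeneous parts]. Then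
`E_k²(z)/binom(d,k)² ≥ E_{k-1}(z)/binom(d,k-1) · E_{k+1}(z)/binom(d,k+1)`, `z ∈ ℝ^n`, `1 ≤ k ≤ d-1`." Proof as
printed: for fixed real `z` the polynomial `y ↦ f_H(z,y) = Σ_k E_k(z) y^{d-k}` is real-rooted (BBL obtain this
from Lemma 4.16; here directly from the real stability of `f_H`, Thm. 4.5, restricted to a line, Prop. 3.1 (1)),
and Newton's inequalities for its coefficients give the display. [cite: BorceaBrandenLiggett2007, §4.3.2 Cor. 4.17] -/
theorem BorceaBrandenLiggett_cor_4_17 {f : MvPolynomial σ ℝ} (hf : IsRealStable f) (hnn : ∀ m, 0 ≤ coeff m f)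
    {d : ℕ} (hd : f.totalDegree ≤ d) (x : σ → ℝ) {k : ℕ} (hk1 : 1 ≤ k) (hkd : k + 1 ≤ d) :
    eval x (homogeneousComponent (k - 1) f) / (d.choose (k - 1) : ℝ) *
        (eval x (homogeneousComponent (k + 1) f) / (d.choose (k + 1) : ℝ)) ≤
      (eval x (homogeneousComponent k f) / (d.choose k : ℝ)) ^ 2 := by
  classical
  -- coefficients of the line polynomial: `a_j = E_{d-j}(x)`; take `j = d - k`
  have hsplit := splits_homogenizeLine hf hnn hd x
  have h := newton_coeff_div_choose hsplit (natDegree_homogenizeLine_le hd x) (j := d - k) (by omega) (by omega)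
  rw [coeff_homogenizeLine hd x (by omega), coeff_homogenizeLine hd x (by omega),
    coeff_homogenizeLine hd x (by omega), show d - (d - k - 1) = k + 1 by omega,
    show d - (d - k + 1) = k - 1 by omega, show d - (d - k) = k by omega,
    show d - k - 1 = d - (k + 1) by omega, show d - k + 1 = d - (k - 1) by omega,
    Nat.choose_symm (by omega : k + 1 ≤ d), Nat.choose_symm (by omega : k - 1 ≤ d),
    Nat.choose_symm (by omega : k ≤ d)] at h
  linarith [h]

/-- Corollary 4.17, cross-multiplied (no binomial denominators):
`(k+1)(d-k+1) · E_{k-1}(x) E_{k+1}(x) ≤ k(d-k) · E_k(x)²`. [cite: BorceaBrandenLiggett2007, §4.3.2 Cor. 4.17] -/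
theorem BorceaBrandenLiggett_cor_4_17' {f : MvPolynomial σ ℝ} (hf : IsRealStable f) (hnn : ∀ m, 0 ≤ coeff m f)
    {d : ℕ} (hd : f.totalDegree ≤ d) (x : σ → ℝ) {k : ℕ} (hk1 : 1 ≤ k) (hkd : k + 1 ≤ d) :
    (((d - k : ℕ) + 1) * (k + 1) : ℝ) *
        (eval x (homogeneousComponent (k - 1) f) * eval x (homogeneousComponent (k + 1) f)) ≤
      ((d - k : ℕ) * k : ℝ) * eval x (homogeneousComponent k f) ^ 2 := by
  classical
  have hsplit := splits_homogenizeLine hf hnn hd x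
  have h := newton_coeff_mul_coeff_le_sq_of_natDegree_le hsplit (natDegree_homogenizeLine_le hd x) (j := d - k)
    (by omega) (by omega)
  rw [coeff_homogenizeLine hd x (by omega), coeff_homogenizeLine hd x (by omega),
    coeff_homogenizeLine hd x (by omega), show d - (d - k - 1) = k + 1 by omega,
    show d - (d - k + 1) = k - 1 by omega, show d - (d - k) = k by omega] at h
  linarith [h]

end Cor417

end Literature.Combinatorics.StablePolynomials

end
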